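import Summits.AtomisticToContinuum.Crystallization.Theorems.FluxTubeKeplerFloorGivesLayered
import Summits.AtomisticToContinuum.Crystallization.Theorems.FluxTubeKeplerFluxCellKeplerSingleScale
import Summits.AtomisticToContinuum.Crystallization.Theorems.FluxTubeKeplerFluxCellKeplerGoodSitesWindows
import Summits.AtomisticToContinuum.Crystallization.Theorems.ChessboardParticlePlanesPeriodicWindowsIffCrystallization
import Summits.AtomisticToContinuum.Crystallization.Theorems.FluxTubeKeplerKeplerEnergyFloor

/-!
# Line `DecayingMarginRung` (margin ladder) — skeleton for the forward rung over `FluxTubeKepler.FloorGivesLayered`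
(crux dir `FluxCellKepler`, stmt-AtomisticToContinuum-15221; fwd-rung G1 gen 10, seed g1-AtomisticToContinuum-15223)

FLOOR (proved, `FluxTubeKeplerFloorGivesLayered.FloorGivesLayered_proof`): for every periodic `P₀`, the energy
floor `N·e(P₀) ≤ E(x)` on Lennard-Jones ground states together with the defect BUDGET
`c(R,η) · #{(R,η)-non-layered sites} ≤ E(x) − N·e(P₀)` — a Kepler-type inequality whose pricing constant `c`
is UNIFORM IN THE SYSTEM SIZE `N` — forces layered windows, hence (proved `PeriodicGivenLayered`) periodic
windows, along every ground-state sequence.  Its proof is QUALITATIVE counting: the only energetic input is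
`E(N) − N·e* = o(N)` (`crysEnergyLimit`), and `c · #bad ≤ o(N)` with `c` fixed leaves an un-priced site.

THE GRADED FAMILY `MarginRung s` (ONE move — one parameter extended: the pricing constant may decay like
`N^{-s}`, i.e. the budget reads `c · #bad ≤ N^s · (E(x) − N·e(P₀))`):
* `MarginRung 0` is the floor (`marginRung_zero`: `N^0 = 1`, the seed + `PeriodicGivenLayered_holds`);
* the dial is ANTITONE (`marginRung_anti`: under FLOOR the excess is non-negative, so a budget with a larger
  exponent is a weaker hypothesis);
* every member is a consequence of the sub-problem (`marginRung_of_crystallization`, on path, via the landed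
  `periodicWindows_of_crystallization`);
* deciding rung `DecayingMarginRung := ∀ s < 1/3, MarginRung s` — "a Kepler certificate whose margin is
  consumed polynomially slowly, `c_N ≥ c·N^{-s}` with `s < 1/3`, still forces crystallization of the ground
  states".  The floor's counting cannot reach it: with `c·N^{-s}` pricing the qualitative excess `o(N)` bounds
  nothing; the new input is the SURFACE-ORDER EXCESS `E(N) ≤ N·e(P₀) + C·N^{2/3}` (trial blocks of the
  attained minimiser `P₀`; the tree has only the rate-free `limsup E(N)/N ≤ e(Q)`,
  `ChargedEnergyGapNegative.limsup_div_le_energyPerParticle`), after which `#bad = O(N^{s+2/3}) = o(N)`.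
* CEILING `s = 1/3`: if the surface tension is positive (`E(N) − N·e* ≥ c'·N^{2/3}`, open item
  `SurfaceTensionNoFoam.SurfaceTensionPositive`), the `s = 1/3` budget holds for EVERY defect predicate, so
  `MarginRung (1/3)` is "attainment ⇒ crystallization" — summit strength; the ladder is capped exactly there.

Stubs (the only `sorry`s): `stub_surfaceExcess` (the new input), `stub_goodOfMargin` (rate counting);
composition `DecayingMarginRung_of` is sorry-free (landed `FluxCellKeplerSketch.stub_layeredWindowsOfGoodSites`
+ proved `PeriodicGivenLayered`).
-/

noncomputable section

namespace Summit.AtomisticToContinuum.Crystallization.Cruxes.FluxCellKepler.MarginLadder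

open Filter Topology
open Literature.MathematicalPhysics.StatisticalMechanics
open Summit.AtomisticToContinuum.Crystallization.Theorems.FluxCellKeplerSingleScale (LayeredGood)

local notation "E3" => EuclideanSpace ℝ (Fin 3)

/-- FLOOR(P₀): `N · e(P₀) ≤ E(x)` for every Lennard-Jones ground state `x` of every size `N`
(verbatim the first hypothesis of `FluxTubeKepler.FloorGivesLayered`). -/
def Floor (P₀ : PeriodicConfiguration 3) : Prop :=
  ∀ (N : ℕ) (x : Fin N → E3), IsGroundState lennardJones x →
    (N : ℝ) * P₀.energyPerParticle lennardJones ≤ interactionEnergy lennardJones x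

/-- MARGIN BUDGET with exponent `s`: for every radius `R > 0` and tolerance `η > 0` some `c > 0` prices the
`(R,η)`-non-layered sites of every Lennard-Jones ground state against `N^s` TIMES the excess energy over
`N · e(P₀)` — i.e. the Kepler pricing constant is only `c · N^{-s}` (`s = 0`: the floor's budget verbatim,
`LayeredGood` = the crux's defect predicate, quantifier order `∀ R η ∃ c` of the crux kept). -/
def MarginBudget (s : ℝ) (P₀ : PeriodicConfiguration 3) : Prop :=
  ∀ R η : ℝ, 0 < R → 0 < η → ∃ c : ℝ, 0 < c ∧
    ∀ (N : ℕ) (x : Fin N → E3), IsGroundState lennardJones x →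
      c * (Nat.card {i : Fin N // ¬ LayeredGood R η x i} : ℝ) ≤
        (N : ℝ) ^ s * (interactionEnergy lennardJones x - (N : ℝ) * P₀.energyPerParticle lennardJones)

/-- Periodic windows at every scale along the sequence `x` (ONE periodic `P`, translations only) —
verbatim the conclusion of `FluxTubeKepler.PeriodicWindows` / `FluxTubeKepler.PeriodicGivenLayered`. -/
def HasPeriodicWindows (x : (N : ℕ) → (Fin N → E3)) : Prop :=
  ∃ P : PeriodicConfiguration 3, ∀ R ε : ℝ, 0 < ε → ∃ᶠ N in atTop, ∃ t : E3,
    (∀ q ∈ P.points, ‖q‖ ≤ R → ∃ i : Fin N, dist (x N i + t) q ≤ ε) ∧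
    (∀ i : Fin N, ‖x N i + t‖ ≤ R → ∃ q ∈ P.points, dist (x N i + t) q ≤ ε)

/-- **The graded family.** `MarginRung s`: FLOOR and the margin budget with exponent `s` force periodic windows
along every Lennard-Jones ground-state sequence. -/
def MarginRung (s : ℝ) : Prop :=
  ∀ P₀ : PeriodicConfiguration 3, Floor P₀ → MarginBudget s P₀ →
    ∀ x : (N : ℕ) → (Fin N → E3), (∀ N, IsGroundState lennardJones (x N)) → HasPeriodicWindows x

/-- **Deciding rung.** Every margin exponent below the surface exponent `1/3` suffices. -/
def DecayingMarginRung : Prop := ∀ s : ℝ, s < 1 / 3 → MarginRung s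

/-! ## F3 — the family specialises to the proved floor -/

/-- At exponent `0` the margin budget IS the floor's budget (`N^0 = 1`). -/
theorem marginBudget_zero_iff (P₀ : PeriodicConfiguration 3) :
    MarginBudget 0 P₀ ↔
      ∀ R η : ℝ, 0 < R → 0 < η → ∃ c : ℝ, 0 < c ∧
        ∀ (N : ℕ) (x : Fin N → E3), IsGroundState lennardJones x →
          c * (Nat.card {i : Fin N // ¬ LayeredGood R η x i} : ℝ) ≤
            interactionEnergy lennardJones x - (N : ℝ) * P₀.energyPerParticle lennardJones := by
  simp only [MarginBudget, Real.rpow_zero, one_mul]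

/-- `MarginRung 0` is the floor: the seed theorem followed by the proved `PeriodicGivenLayered`. -/
theorem marginRung_zero : MarginRung 0 := fun P₀ hF hB x hx =>
  Theses.FluxTubeKepler.PeriodicGivenLayered_holds x hx
    (Theorems.FluxTubeKeplerFloorGivesLayered.FloorGivesLayered_proof P₀ hF
      ((marginBudget_zero_iff P₀).1 hB) x hx)

/-! ## Dial monotonicity (harder-to-easier = decreasing exponent) -/

/-- Under FLOOR the margin budget is monotone in the exponent: a larger exponent is a weaker hypothesis. -/
theorem marginBudget_mono {s s' : ℝ} (h : s ≤ s') {P₀ : PeriodicConfiguration 3} (hF : Floor P₀) :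
    MarginBudget s P₀ → MarginBudget s' P₀ := by
  intro hB R η hR hη
  obtain ⟨c, hc, hcN⟩ := hB R η hR hη
  refine ⟨c, hc, fun N x hx => ?_⟩
  have hX : 0 ≤ interactionEnergy lennardJones x - (N : ℝ) * P₀.energyPerParticle lennardJones :=
    sub_nonneg.2 (hF N x hx)
  rcases Nat.eq_zero_or_pos N with rfl | hN
  · have hcard : Nat.card {i : Fin 0 // ¬ LayeredGood R η x i} = 0 := by simp
    rw [hcard]
    calc c * ((0 : ℕ) : ℝ) = 0 := by simp
      _ ≤ ((0 : ℕ) : ℝ) ^ s' *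
            (interactionEnergy lennardJones x - ((0 : ℕ) : ℝ) * P₀.energyPerParticle lennardJones) :=
          mul_nonneg (Real.rpow_nonneg (Nat.cast_nonneg 0) _) hX
  · have h1 : (1 : ℝ) ≤ N := by exact_mod_cast hN
    exact (hcN N x hx).trans
      (mul_le_mul_of_nonneg_right (Real.rpow_le_rpow_of_exponent_le h1 h) hX)

/-- `MarginRung` is antitone in the exponent. -/
theorem marginRung_anti {s s' : ℝ} (h : s ≤ s') : MarginRung s' → MarginRung s :=
  fun H P₀ hF hB x hx => H P₀ hF (marginBudget_mono h hF hB) x hx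

/-- Every fixed member with positive exponent below `1/3` is implied by the deciding rung. -/
theorem marginRung_of_decayingMarginRung {s : ℝ} (hs : s < 1 / 3) (h : DecayingMarginRung) :
    MarginRung s := h s hs

/-- The deciding rung gives back the floor (informational `specialises`). -/
theorem marginRung_zero_of_decayingMarginRung (h : DecayingMarginRung) : MarginRung 0 :=
  h 0 (by norm_num)

/-! ## F4 — on-path lemmas: the sub-problem implies every member -/

/-- ON-PATH: `Crystallization → MarginRung s` (landed hull-criterion converse
`periodicWindows_of_crystallization`). -/
theorem marginRung_of_crystallization (s : ℝ) (h : _root_.Crystallization) : MarginRung s :=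
  fun _ _ _ x hx =>
    Theorems.ChessboardParticlePlanesPeriodicWindowsIffCrystallization.periodicWindows_of_crystallization h x hx

/-- ON-PATH for the deciding rung (tagged `aesop safe apply` so that the tribunal's fixed
`S → C` portfolio — `simpa using h`, `aesop` — finds it). -/
@[aesop safe apply]
theorem DecayingMarginRung_of_Crystallization (h : _root_.Crystallization) : DecayingMarginRung :=
  fun s _ => marginRung_of_crystallization s h

/-! ## How the rung relieves the parent crux `FluxCellKepler` (documentation, sorry-free)

With `MarginRung s` in hand (`0 ≤ s < 1/3`) the route `FluxTubeKepler` needs its Kepler-type budget only with a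
size-dependent constant `c_N ≥ c · N^{-s}`: `MarginKeplerFloor s` below is the conclusion of the PROVED
`KeplerEnergyFloor` with the budget relaxed by the factor `N^s`, and `MarginRung s → MarginKeplerFloor s →
Crystallization`. -/

/-- The floor-and-margin-budget package (what a Kepler inequality with margin `c · N^{-s}` delivers). -/
def MarginKeplerFloor (s : ℝ) : Prop := ∃ P₀ : PeriodicConfiguration 3, Floor P₀ ∧ MarginBudget s P₀

theorem crystallization_of_marginRung {s : ℝ} (h : MarginRung s) (hK : MarginKeplerFloor s) :
    _root_.Crystallization := by
  obtain ⟨P₀, hF, hB⟩ := hK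
  exact Theorems.ChessboardParticlePlanesPeriodicWindowsIffCrystallization.crystallization_of_periodicWindows
    (fun x hx => h P₀ hF hB x hx)

/-- The parent crux gives the package at every exponent `s ≥ 0` (proved `KeplerEnergyFloor` + minimal distance +
monotonicity of the dial). -/
theorem marginKeplerFloor_of_fluxCellKepler {s : ℝ} (hs : 0 ≤ s) (hK : Theses.FluxTubeKepler.FluxCellKepler) :
    MarginKeplerFloor s := by
  obtain ⟨P₀, hF, hB⟩ := Theorems.keplerEnergyFloor_proof hK LennardJonesMinimalDistance_holds
  exact ⟨P₀, hF, marginBudget_mono hs hF ((marginBudget_zero_iff P₀).2 fun R η hR hη => hB R η hR hη)⟩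

/-! ## The line: surface-order excess + rate counting

The floor's Step 1 (`eventually_exists_not_bad`) with RATES.  Two declared stubs. -/

/-- **Stub 1 — SURFACE-ORDER EXCESS (the new input; load-bearing).** For every periodic configuration `P₀`
of `ℝ³` there is `C` with `E(N) ≤ N · e(P₀) + C · N^{2/3}` for all `N`: blocks of `K³` cells of `P₀`, trimmed
to exactly `N` points (at most `3|motif|K²` deletions, each raising the energy by a bounded site energy), are
injective trial states; the interactions lost across the block boundary are bounded by the sixth-power tails
`Σ_{depth ℓ} K² · ℓ^{-3} = O(K²) = O(N^{2/3})` (quantitative form of the landed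
`ChargedEnergyGapNegative.limsup_div_le_energyPerParticle` / `BlocksBound`, which only give `o(N)`).
[folklore; BlancLewin2015 §2.1] -/
theorem stub_surfaceExcess :
    ∀ P₀ : PeriodicConfiguration 3, ∃ C : ℝ, ∀ N : ℕ,
      groundStateEnergy lennardJones 3 N ≤
        (N : ℝ) * P₀.energyPerParticle lennardJones + C * (N : ℝ) ^ (2 / 3 : ℝ) := by
  sorry

/-- **Stub 2 — RATE COUNTING.** Under FLOOR, a margin budget with exponent `s < 1/3` and a surface-order
excess bound leave, for every scale `(R, η)` and all large `N`, an `(R, η)`-layered-good site in EVERY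
Lennard-Jones ground state of size `N`: `c · #bad ≤ N^s · (E(N) − N·e(P₀)) ≤ C · N^{s + 2/3}`, and
`N^{s + 2/3} < (c/C) · N` for `N` large since `s + 2/3 < 1`, so not all `N` sites are bad. [folklore] -/
theorem stub_goodOfMargin :
    ∀ s : ℝ, s < 1 / 3 → ∀ P₀ : PeriodicConfiguration 3, Floor P₀ → MarginBudget s P₀ →
      (∃ C : ℝ, ∀ N : ℕ, groundStateEnergy lennardJones 3 N ≤
        (N : ℝ) * P₀.energyPerParticle lennardJones + C * (N : ℝ) ^ (2 / 3 : ℝ)) →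
      ∀ R η : ℝ, 0 < R → 0 < η → ∀ᶠ N in atTop, ∀ x : Fin N → E3, IsGroundState lennardJones x →
        ∃ i : Fin N, LayeredGood R η x i := by
  sorry

/-! ### The stub statements as named propositions (verbatim) -/

/-- Statement of `stub_surfaceExcess` (verbatim). [folklore] -/
def Sig.stub_surfaceExcess : Prop :=
    ∀ P₀ : PeriodicConfiguration 3, ∃ C : ℝ, ∀ N : ℕ,
      groundStateEnergy lennardJones 3 N ≤
        (N : ℝ) * P₀.energyPerParticle lennardJones + C * (N : ℝ) ^ (2 / 3 : ℝ)

/-- Statement of `stub_goodOfMargin` (verbatim). [folklore] -/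
def Sig.stub_goodOfMargin : Prop :=
    ∀ s : ℝ, s < 1 / 3 → ∀ P₀ : PeriodicConfiguration 3, Floor P₀ → MarginBudget s P₀ →
      (∃ C : ℝ, ∀ N : ℕ, groundStateEnergy lennardJones 3 N ≤
        (N : ℝ) * P₀.energyPerParticle lennardJones + C * (N : ℝ) ^ (2 / 3 : ℝ)) →
      ∀ R η : ℝ, 0 < R → 0 < η → ∀ᶠ N in atTop, ∀ x : Fin N → E3, IsGroundState lennardJones x →
        ∃ i : Fin N, LayeredGood R η x i

/-! ### The skeleton theorem: the rung BY NAME from the two stub statements (sorry-free) -/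

/-- **Assembly.** `stub_surfaceExcess → stub_goodOfMargin → DecayingMarginRung`: for `s < 1/3`, under FLOOR and
the margin budget, the surface-order excess bound (Stub 1) and rate counting (Stub 2) give, at every scale,
eventually-in-`N` a good site in every ground state, hence frequently along the sequence; the landed
`FluxCellKeplerSketch.stub_layeredWindowsOfGoodSites` (Steps 2–3 of the seed: one spacing by compactness,
transfer by dilation) turns good sites into layered windows, and the proved `PeriodicGivenLayered` into
periodic windows. -/
theorem DecayingMarginRung_of (h₁ : Sig.stub_surfaceExcess) (h₂ : Sig.stub_goodOfMargin) :
    DecayingMarginRung := by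
  intro s hs P₀ hF hB x hx
  refine Theses.FluxTubeKepler.PeriodicGivenLayered_holds x hx
    (Theorems.FluxCellKeplerSketch.stub_layeredWindowsOfGoodSites x ?_)
  intro R η hR hη
  exact ((h₂ s hs P₀ hF hB (h₁ P₀) R η hR hη).mono fun N hN => hN (x N) (hx N)).frequently

/-- **The closed skeleton instance**: the rung by name from the two declared stubs (the only `sorry`s of this
file enter here). [conjecture] -/
theorem DecayingMarginRung_skeleton : DecayingMarginRung :=
  DecayingMarginRung_of stub_surfaceExcess stub_goodOfMargin

end Summit.AtomisticToContinuum.Crystallization.Cruxes.FluxCellKepler.MarginLadder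

end
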